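import Literature.NumberTheory.DiophantineGeometry.FunctionFieldSchmidtDegreeOneProofs
import HarnessLib

/-!
# Consequences of F. K. Schmidt's theorem `∂ = 1`: the `L`-polynomial (Stichtenoth Thm. 5.1.15 (a))
and the Weil-zeta genus bridge given Hasse–Weil

Sibling **proof file** (theorems only; D-0014). With `minPosDegree_eq_one_holds`
(`FunctionFieldSchmidtDegreeOneProofs`: F. K. Schmidt's `∂ = 1`, Stichtenoth Cor. 5.1.11) in the tree,
the conditional theorems of `FunctionFieldSchmidtDegreeOne` become:

* `lSeries_eq_polynomial_holds` — **discharge of the named fact `lSeries_eq_polynomial`** of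
  `FunctionFieldZeta` (**Stichtenoth Thm. 5.1.15 (a)**: for a function field `F/𝔽_q` with full
  constant field `𝔽_q` and genus `g`, the `L`-polynomial `L(t) = (1 - t)(1 - qt) Z(t)` lies in `ℤ[t]`
  and has degree `2g`), via `lSeries_eq_polynomial_of_minPosDegree_eq_one_fact` (the tree's proof of
  Thm. 5.1.15 (a) from `∂ = 1`, the Riemann–Roch theorem `riemann_roch_holds` and Lemma 5.1.4,
  `FunctionFieldZetaRationalityProofs`);
* `isGenus_genus_of_hasseWeil` — the bridge fact `AlgFunctionField.isGenus_genus` of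
  `FunctionFieldGenus` (the Riemann–Roch genus is G16's Weil-zeta genus `IsGenus 𝔽_q F g`:
  `N_n = qⁿ + 1 - ∑_{i=1}^{2g} αᵢⁿ` with `|αᵢ| = √q`, Cor. 5.1.16) now depends only on the one
  remaining named fact `hasseWeil` (**Stichtenoth Thm. 5.2.1**, the Hasse–Weil theorem / Riemann
  hypothesis for function fields, Weil 1948), via `isGenus_genus_of_schmidt_of_hasseWeil`.

## References

* H. Stichtenoth, *Algebraic Function Fields and Codes*, 2nd ed., GTM 254, Springer 2009, §5.1
  (Cor. 5.1.11, Thm. 5.1.15, Cor. 5.1.16), §5.2 (Thm. 5.2.1). [Stichtenoth2009]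
* F. K. Schmidt, *Analytische Zahlentheorie in Körpern der Charakteristik p*, Math. Z. 33 (1931),
  1–32. [Schmidt1931]
* A. Weil, *Sur les courbes algébriques et les variétés qui s'en déduisent*, Hermann 1948. [Weil1948]
-/

noncomputable section

namespace Literature.NumberTheory.DiophantineGeometry.AlgFunctionField

universe u v

variable {K : Type u} {F : Type v} [Field K] [Field F] [Algebra K F]

section LPolynomial

variable [Fintype K]

/-- **Discharge of `lSeries_eq_polynomial` — Stichtenoth Thm. 5.1.15 (a)** (F. K. Schmidt 1931):
for an algebraic function field `F/𝔽_q` of one variable with full constant field `𝔽_q` and genus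
`g`, the `L`-polynomial `L(t) = (1 - t)(1 - qt) Z(t)` is a polynomial in `ℤ[t]` of degree `2g`.
From `∂ = 1` (`minPosDegree_eq_one_holds`) by `lSeries_eq_polynomial_of_minPosDegree_eq_one_fact`.
[cite: Stichtenoth2009, Thm. 5.1.15(a)] -/
theorem lSeries_eq_polynomial_holds : lSeries_eq_polynomial K F :=
  lSeries_eq_polynomial_of_minPosDegree_eq_one_fact (minPosDegree_eq_one_holds K F)

/-- Pointwise form of Thm. 5.1.15 (a): there is `L ∈ ℤ[t]` of degree `2g` with
`L(t) = (1 - t)(1 - qt) Z(t)`. [cite: Stichtenoth2009, Thm. 5.1.15(a)] -/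
theorem exists_lPolynomial [IsAlgFunctionField K F] [IsIntegrallyClosedIn K F] :
    ∃ L : Polynomial ℤ, L.natDegree = 2 * genus K F ∧ (L : PowerSeries ℤ) = lSeries K F :=
  lSeries_eq_polynomial_holds

end LPolynomial

/-- **The bridge fact `isGenus_genus` from the Hasse–Weil theorem alone**: for a function field
`F/𝔽_q` with full constant field `𝔽_q`, Weil's form of the genus, `IsGenus 𝔽_q F (genus 𝔽_q F)`
(`N_n = qⁿ + 1 - ∑_{i=1}^{2g} αᵢⁿ` for all `n ≥ 1` with `|αᵢ| = √q`, Stichtenoth Cor. 5.1.16 with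
Thm. 5.2.1), follows from Thm. 5.2.1 (`hasseWeil`, the one remaining named fact), F. K. Schmidt's
theorem being proved (`minPosDegree_eq_one_holds`). Relies on: hypothesis `hHW`.
[cite: Weil1948] [cite: Stichtenoth2009, Cor. 5.1.16 and Thm. 5.2.1] -/
theorem isGenus_genus_of_hasseWeil {Fq F : Type} [Field Fq] [Fintype Fq] [Field F] [Algebra Fq F]
    (hHW : hasseWeil Fq F) : isGenus_genus Fq F :=
  isGenus_genus_of_schmidt_of_hasseWeil (minPosDegree_eq_one_holds Fq F) hHW

end Literature.NumberTheory.DiophantineGeometry.AlgFunctionField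

end
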